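import Literature.Barriers.CriticalPhenomena.GaussianDominationRouteLatticeConv
import Literature.Barriers.CriticalPhenomena.GaussianDominationRouteF3
import Literature.Barriers.CriticalPhenomena.GaussianDominationRouteLaceExpansion
import Mathlib.Analysis.SpecificLimits.Basic
import HarnessLib

/-!
# Towards `HaraSlade1990_infraredBound_holds`, VIII (v4): the analytic toolkit of the step
# "Prop. 8.3 subject to Lemma 8.4" — Tonelli over `ℕ × ℤ^d`, the alternating series
# `Π = Σ_N (-1)^N Π^{(N)}`, the limit `M → ∞` in (6.2.2) — and `(J ⋆ f)(y) = p Σⱼ [f(y∓eⱼ)]`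

Sibling proof file of `GaussianDominationRoute*.lean` (barrier catalogue
`Literature/Barriers/CriticalPhenomena/`). Heydenreich–van der Hofstad's "Proof of Prop. 8.3
subject to Lem. 8.4" (pp. 97–98 with §6.3): given the expansion with remainder
`τ = δ + J⋆τ + Π_M⋆J⋆τ + Π_M + R_M` (Prop. 6.1, (6.2.2)) for every `M`, the remainder bound
(6.3.1)–(6.3.2) and the coefficient bounds of Lemma 8.4 ((8.3.5)–(8.3.6)), one sums the geometric
series over `N` (Tonelli), lets `M → ∞` (dominated convergence, `R_M → 0`) to get (6.1.2)
`τ = δ + J⋆τ + Π⋆J⋆τ + Π` with `Π = Σ_N (-1)^N Π^{(N)}`, and takes the Fourier transform. This file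
holds that analysis for an ABSTRACT family `(Π^{(N)})_N` of non-negative summable functions with
`Σ_x Π^{(N)} ≤ r^{N∨1}`, `r ≤ 1/2` (`tonelli_nat_site`, `lace_envelope`, `lace_series` — absolute
convergence and `Σ_x |Π| ≤ 4r`, (8.3.1) —, `lace_series_weighted` — (8.3.2) —,
`lace_identity_of_remainder` — the limit `M → ∞` —, `cosFT_add_four`), together with two small
lemmas about the objects of `GaussianDominationRouteLaceExpansion.lean`: `latticeConv_bondJ`
(`(J⋆f)(y) = p Σⱼ [f(y - eⱼ) + f(y + eⱼ)]`, the kernel `J = p𝟙{·∼0}` of (6.2.1) being supported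
on `±eⱼ`) and `toReal_lacePiT` (`Π̃^{(M)} = Π^{(M)} + δ_{M,0}δ_0`).

The derivation of Prop. 8.3 itself from the four named facts about the ACTUAL coefficients
`lacePi d p N = Π^{(N)}` of Ch. 6 (`HvdH2017_prop61`, `HvdH2017_eq632`, `HvdH2017_lemma84`,
`HvdH2017_piN_symm`) is `HvdH2017_prop83_of_prop61_eq632_lemma84`
(`GaussianDominationRouteProp83.lean`), whence `HaraSlade1990_infraredBound_of_prop61_eq632_lemma84`.

**History (v1 → v4) and the remainder bound at `M = 0`.** Version 1 of this file (p21680)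
vendored Prop. 6.1 + (6.3.2) + Lemma 8.4 as ONE existential named fact `HvdH2017_prop61_lemma84`
and derived Prop. 8.3 from it. Its remainder clause copied the printed (6.3.2),
`|R_M(x)| ≤ Σ_{u,v} Π^{(M)}(u) J(u,v) τ(x - v)`, for every `M`; but for `M = 0` the remainder
`R_0(x) = -Σ_{(u,v)} J(u,v) 𝔼₀[𝟙_{0⇔u} P₁(v ↔ x through C̃₀^{(u,v)}(0))]` of (6.2.20) contains
the terms `u = 0` (`0 ⇔ 0` is the sure event, Def. 6.3(a)), so that (6.3.1) only gives
`|R_0(x)| ≤ Σ_{u,v} [Π^{(0)}(u) + δ_{0,u}] J(u,v) τ(x - v) = (Π^{(0)}⋆J⋆τ)(x) + (J⋆τ)(x)` (as the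
tree's `HvdH2017_eq632` states it); with (6.2.2) at `M = 0` the printed form would force
`τ(x) ≥ (J⋆τ)(x)` for `x ≠ 0`, contradicting the strict BK bound (7.2.10) at small `p > 0`. That
fact is therefore unsatisfiable (for `K ≥ 2`): v3 marked it REFUTED and removed the two
implications v1 derived from it (`HvdH2017_prop83_of_prop61_lemma84`,
`HaraSlade1990_infraredBound_of_prop61_lemma84` — vacuous), and v4 (this version) RETIRES the
definition itself — a refuted `def … : Prop` is not a fact to be discharged; its negation, with
the statement written out in full, stays proved as `not_HvdH2017_prop61_lemma84` in
`GaussianDominationRouteExpansionM0.lean`, the record of the erratum. The obligation it was cut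
from is served by the four separate named facts about the ACTUAL coefficients (above; three of
them are discharged: `HvdH2017_prop61_holds`, `HvdH2017_eq632_holds`, `HvdH2017_piN_symm_holds`)
and the chain `HaraSlade1990_infraredBound_of_lemma84` of
`GaussianDominationRouteLemma84Assembly.lean`; `lace_identity_of_remainder` below carries the
corrected remainder `(Π^{(M)}⋆Jt)(x) + 𝟙{M = 0} Jt(x)`. The use of (6.3.2) in the source
(`R_M → 0`, (6.3.4)) is unaffected.

## References

* M. Heydenreich, R. van der Hofstad, *Progress in High-Dimensional Percolation and Random
  Graphs* (Springer 2017): Prop. 6.1 ((6.2.1)–(6.2.4)), (6.2.7), (6.2.20), §6.3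
  ((6.3.1)–(6.3.4)), (6.1.2)–(6.1.3), Prop. 8.3, Lemma 8.4 ((8.3.5)–(8.3.6)), "Proof of Prop. 8.3
  subject to Lem. 8.4" (pp. 97–98).
* T. Hara, G. Slade, Comm. Math. Phys. 128 (1990) 333–391: Prop. 2.3 (the expansion with
  remainder), Prop. 2.4, Lemma 4.5 ((4.4)–(4.6)).
-/

noncomputable section

namespace Literature.Barriers.CriticalPhenomena

open MeasureTheory Filter Topology Literature.Probability.LatticeModels Literature.Probability.Percolation
open scoped BigOperators

variable {d : ℕ}

/-! ### Tonelli for a nonnegative family indexed by `ℕ × ℤ^d`; geometric bookkeeping -/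

/-- **Tonelli on `ℕ × ℤ^d`**: if `F ≥ 0`, every row `F N` is summable with `Σ_x F(N,x) ≤ g(N)` and
`g` is summable, then `x ↦ Σ_N F(N,x)` is summable, each column `N ↦ F(N,x)` is summable, and
`Σ_x Σ_N F(N,x) ≤ Σ_N g(N)`. [folklore] -/
theorem tonelli_nat_site {F : ℕ → Site d → ℝ} (hF0 : ∀ N x, 0 ≤ F N x) (hrow : ∀ N, Summable (F N))
    {g : ℕ → ℝ} (hg : Summable g) (hle : ∀ N, ∑' x, F N x ≤ g N) :
    (Summable fun x => ∑' N, F N x) ∧ (∀ x, Summable fun N => F N x) ∧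
      ∑' x, ∑' N, F N x ≤ ∑' N, g N := by
  have hU : Summable (Function.uncurry F) := by
    refine (summable_prod_of_nonneg fun q => hF0 q.1 q.2).2 ⟨fun N => hrow N, ?_⟩
    exact Summable.of_nonneg_of_le (fun N => tsum_nonneg fun x => hF0 N x) hle hg
  refine ⟨hU.prod_symm.prod, fun x => hU.prod_symm.prod_factor x, ?_⟩
  rw [hU.tsum_comm]
  exact Summable.tsum_le_tsum hle hU.prod hg

/-- For `0 ≤ r ≤ 1/2`: `r^{N∨1} ≤ 2r (1/2)^N`. [folklore] -/
theorem pow_max_one_le {r : ℝ} (hr0 : 0 ≤ r) (hr : r ≤ 1 / 2) (N : ℕ) :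
    r ^ max N 1 ≤ 2 * r * (1 / 2) ^ N := by
  rcases Nat.eq_zero_or_pos N with hN | hN
  · subst hN; simp; linarith
  · rw [max_eq_left hN]
    obtain ⟨m, rfl⟩ : ∃ m, N = m + 1 := ⟨N - 1, by omega⟩
    rw [pow_succ, pow_succ]
    have h1 : r ^ m ≤ (1 / 2) ^ m := pow_le_pow_left₀ hr0 hr m
    have h2 : 0 ≤ (1 / 2 : ℝ) ^ m := by positivity
    nlinarith

/-- For `0 ≤ r ≤ 1/2`: `r^{(N-1)∨1} ≤ 4r (1/2)^N`. [folklore] -/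
theorem pow_max_sub_one_le {r : ℝ} (hr0 : 0 ≤ r) (hr : r ≤ 1 / 2) (N : ℕ) :
    r ^ max (N - 1) 1 ≤ 4 * r * (1 / 2) ^ N := by
  rcases Nat.lt_or_ge N 2 with hN | hN
  · interval_cases N
    · simp; linarith
    · simp; linarith
  · rw [max_eq_left (by omega)]
    obtain ⟨m, rfl⟩ : ∃ m, N = m + 2 := ⟨N - 2, by omega⟩
    rw [show m + 2 - 1 = m + 1 by omega, pow_succ, pow_succ, pow_succ]
    have h1 : r ^ m ≤ (1 / 2) ^ m := pow_le_pow_left₀ hr0 hr m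
    have h2 : 0 ≤ (1 / 2 : ℝ) ^ m := by positivity
    nlinarith

/-- `Σ_N 2r(1/2)^N = 4r` and summability. [folklore] -/
theorem summable_geom_aux (r : ℝ) (c : ℝ) : Summable fun N : ℕ => c * r * (1 / 2 : ℝ) ^ N :=
  (summable_geometric_two.mul_left (c * r))

/-- `Σ_N c r (1/2)^N = 2 c r`. [folklore] -/
theorem tsum_geom_aux (r c : ℝ) : ∑' N : ℕ, c * r * (1 / 2 : ℝ) ^ N = 2 * (c * r) := by
  rw [tsum_mul_left, tsum_geometric_two]; ring

/-! ### The alternating series and the limit `M → ∞` -/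

/-- `cosFT` of a four-term sum, termwise (all four cosine-weighted families summable). [folklore] -/
theorem cosFT_add_four {A B C D : Site d → ℝ} (hA : Summable A) (hB : Summable B) (hC : Summable C)
    (hD : Summable D) (k : Fin d → ℝ) :
    cosFT (fun x => A x + B x + C x + D x) k = cosFT A k + cosFT B k + cosFT C k + cosFT D k := by
  have sA := summable_cos_kdot_mul hA k
  have sB := summable_cos_kdot_mul hB k
  have sC := summable_cos_kdot_mul hC k
  have sD := summable_cos_kdot_mul hD k
  simp only [cosFT]
  rw [← sA.tsum_add sB, ← (sA.add sB).tsum_add sC, ← ((sA.add sB).add sC).tsum_add sD]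
  exact tsum_congr fun x => by ring

section Derivation

variable {Ps : ℕ → Site d → ℝ} (hP0 : ∀ N x, 0 ≤ Ps N x) (hPs : ∀ N, Summable (Ps N))
  {r : ℝ} (hr0 : 0 ≤ r) (hr12 : r ≤ 1 / 2) (hP1 : ∀ N, ∑' x, Ps N x ≤ r ^ max N 1)
include hP0 hPs hr0 hr12 hP1

/-- The columns `N ↦ Π^{(N)}(x)`, the envelope `G(x) = Σ_N Π^{(N)}(x)` and `Σ_x G ≤ 4r`
(Tonelli with (8.3.5)). [cite: HeydenreichVanDerHofstad2017, (6.3.3) and (8.3.5)] -/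
theorem lace_envelope :
    (Summable fun x => ∑' N, Ps N x) ∧ (∀ x, Summable fun N => Ps N x) ∧
      ∑' x, ∑' N, Ps N x ≤ 4 * r := by
  obtain ⟨h1, h2, h3⟩ := tonelli_nat_site hP0 hPs (summable_geom_aux r 2)
    fun N => (hP1 N).trans (pow_max_one_le hr0 hr12 N)
  rw [tsum_geom_aux] at h3
  exact ⟨h1, h2, by linarith⟩

/-- **The alternating series `Π = Σ_N (-1)^N Π^{(N)}`** converges absolutely; `|Π| ≤ G`, `Π` is
summable and `Σ_x |Π(x)| ≤ 4r` ((8.3.1)). [cite: HeydenreichVanDerHofstad2017, (6.3.3) and (8.3.1)] -/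
theorem lace_series :
    (∀ x, Summable fun N => (-1 : ℝ) ^ N * Ps N x) ∧
      (∀ x, |∑' N, (-1 : ℝ) ^ N * Ps N x| ≤ ∑' N, Ps N x) ∧
      (Summable fun x => ∑' N, (-1 : ℝ) ^ N * Ps N x) ∧
      ∑' x, |∑' N, (-1 : ℝ) ^ N * Ps N x| ≤ 4 * r := by
  obtain ⟨hGs, hcol, hGle⟩ := lace_envelope hP0 hPs hr0 hr12 hP1
  have hnormN : ∀ N x, ‖(-1 : ℝ) ^ N * Ps N x‖ = Ps N x := fun N x => by
    rw [norm_mul, norm_pow, norm_neg, norm_one, one_pow, one_mul, Real.norm_eq_abs,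
      abs_of_nonneg (hP0 N x)]
  have hPfN : ∀ x, Summable fun N => (-1 : ℝ) ^ N * Ps N x := fun x =>
    Summable.of_norm_bounded (hcol x) fun N => (hnormN N x).le
  have hPfabs : ∀ x, |∑' N, (-1 : ℝ) ^ N * Ps N x| ≤ ∑' N, Ps N x := fun x => by
    rw [← Real.norm_eq_abs]
    refine (norm_tsum_le_tsum_norm ?_).trans (le_of_eq (tsum_congr fun N => hnormN N x))
    exact (hcol x).congr fun N => (hnormN N x).symm
  have hPfs : Summable fun x => ∑' N, (-1 : ℝ) ^ N * Ps N x :=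
    Summable.of_norm_bounded hGs fun x => by rw [Real.norm_eq_abs]; exact hPfabs x
  refine ⟨hPfN, hPfabs, hPfs, ?_⟩
  exact (Summable.tsum_le_tsum hPfabs hPfs.abs hGs).trans hGle

/-- **(8.3.2)**: `Σ_x [1 - cos(k·x)] |Π(x)| ≤ 8r [1 - D̂(k)]` from (8.3.6) (Tonelli).
[cite: HeydenreichVanDerHofstad2017, (8.3.2) and (8.3.6)] -/
theorem lace_series_weighted
    (hP2 : ∀ (N : ℕ) (k : Fin d → ℝ),
      ∑' x, (1 - Real.cos (kdot k x)) * Ps N x ≤ (1 - Dhat d k) * r ^ max (N - 1) 1)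
    (k : Fin d → ℝ) :
    ∑' x, (1 - Real.cos (kdot k x)) * |∑' N, (-1 : ℝ) ^ N * Ps N x| ≤ 8 * r * (1 - Dhat d k) := by
  obtain ⟨-, hPfabs, hPfs, -⟩ := lace_series hP0 hPs hr0 hr12 hP1
  have hw0 : ∀ x : Site d, 0 ≤ 1 - Real.cos (kdot k x) := fun x => sub_nonneg.2 (Real.cos_le_one _)
  have hw2 : ∀ x : Site d, 1 - Real.cos (kdot k x) ≤ 2 := fun x => by
    linarith [Real.neg_one_le_cos (kdot k x)]
  have hDk := one_sub_Dhat_nonneg k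
  obtain ⟨hWs, -, hWle⟩ := tonelli_nat_site (F := fun N x => (1 - Real.cos (kdot k x)) * Ps N x)
    (fun N x => mul_nonneg (hw0 x) (hP0 N x))
    (fun N => Summable.of_norm_bounded ((hPs N).mul_left 2) fun x => by
      rw [Real.norm_eq_abs, abs_mul, abs_of_nonneg (hw0 x), abs_of_nonneg (hP0 N x)]
      exact mul_le_mul_of_nonneg_right (hw2 x) (hP0 N x))
    ((summable_geom_aux r 4).mul_left (1 - Dhat d k))
    (fun N => (hP2 N k).trans (mul_le_mul_of_nonneg_left (pow_max_sub_one_le hr0 hr12 N) hDk))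
  rw [tsum_mul_left, tsum_geom_aux] at hWle
  have hpt : ∀ x, (1 - Real.cos (kdot k x)) * |∑' N, (-1 : ℝ) ^ N * Ps N x| ≤
      ∑' N, (1 - Real.cos (kdot k x)) * Ps N x := fun x => by
    rw [tsum_mul_left]
    exact mul_le_mul_of_nonneg_left (hPfabs x) (hw0 x)
  have hls : Summable fun x => (1 - Real.cos (kdot k x)) * |∑' N, (-1 : ℝ) ^ N * Ps N x| :=
    Summable.of_norm_bounded (hPfs.abs.mul_left 2) fun x => by
      rw [Real.norm_eq_abs, abs_mul, abs_of_nonneg (hw0 x), abs_abs]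
      exact mul_le_mul_of_nonneg_right (hw2 x) (abs_nonneg _)
  calc _ ≤ ∑' x, ∑' N, (1 - Real.cos (kdot k x)) * Ps N x := Summable.tsum_le_tsum hpt hls hWs
    _ ≤ (1 - Dhat d k) * (2 * (4 * r)) := hWle
    _ = 8 * r * (1 - Dhat d k) := by ring

/-- **The limit `M → ∞` in (6.2.2)**: with a bounded nonnegative kernel `Jt` (`0 ≤ Jt ≤ B`) and the
remainder bound (6.3.1)–(6.3.2) (in the corrected form `|R_M(x)| ≤ (Π^{(M)}⋆Jt)(x) + 𝟙{M=0} Jt(x)`,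
see the module docstring), the expansion with remainder gives (6.1.2):
`τ(x) = δ(x) + Jt(x) + Σ_u Π(u) Jt(x - u) + Π(x)`.
[cite: HeydenreichVanDerHofstad2017, §6.3 ((6.3.1)–(6.3.4)) and (6.1.2)] -/
theorem lace_identity_of_remainder {τ δ Jt : Site d → ℝ} {B : ℝ} (hJt0 : ∀ y, 0 ≤ Jt y)
    (hJtle : ∀ y, Jt y ≤ B)
    (hexp : ∀ (M : ℕ) (x : Site d),
      |τ x - (δ x + Jt x + ∑' u, (∑ N ∈ Finset.range (M + 1), (-1 : ℝ) ^ N * Ps N u) * Jt (x - u) +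
          ∑ N ∈ Finset.range (M + 1), (-1 : ℝ) ^ N * Ps N x)| ≤
        ∑' u, Ps M u * Jt (x - u) + if M = 0 then Jt x else 0)
    (x : Site d) :
    τ x = δ x + Jt x + (∑' u, (∑' N, (-1 : ℝ) ^ N * Ps N u) * Jt (x - u)) + ∑' N, (-1 : ℝ) ^ N * Ps N x := by
  obtain ⟨hGs, hcol, -⟩ := lace_envelope hP0 hPs hr0 hr12 hP1
  obtain ⟨hPfN, -, -, -⟩ := lace_series hP0 hPs hr0 hr12 hP1
  have hB0 : 0 ≤ B := (hJt0 0).trans (hJtle 0)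
  have hJtabs : ∀ y, |Jt y| ≤ B := fun y => by rw [abs_of_nonneg (hJt0 y)]; exact hJtle y
  -- `Π_M(x) → Π(x)`
  have hlimP : ∀ u, Tendsto (fun M : ℕ => ∑ N ∈ Finset.range (M + 1), (-1 : ℝ) ^ N * Ps N u) atTop
      (𝓝 (∑' N, (-1 : ℝ) ^ N * Ps N u)) := fun u =>
    ((hPfN u).tendsto_sum_tsum_nat).comp (tendsto_add_atTop_nat 1)
  -- `|Π_M| ≤ G`
  have hpart : ∀ M u, |∑ N ∈ Finset.range (M + 1), (-1 : ℝ) ^ N * Ps N u| ≤ ∑' N, Ps N u := by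
    intro M u
    calc |∑ N ∈ Finset.range (M + 1), (-1 : ℝ) ^ N * Ps N u|
        ≤ ∑ N ∈ Finset.range (M + 1), |(-1 : ℝ) ^ N * Ps N u| := Finset.abs_sum_le_sum_abs _ _
      _ = ∑ N ∈ Finset.range (M + 1), Ps N u := Finset.sum_congr rfl fun N _ => by
          rw [abs_mul, abs_pow, abs_neg, abs_one, one_pow, one_mul, abs_of_nonneg (hP0 N u)]
      _ ≤ ∑' N, Ps N u := (hcol u).sum_le_tsum _ fun N _ => hP0 N u
  -- dominated convergence for the convolution term
  have hlimConv : Tendsto (fun M : ℕ => ∑' u, (∑ N ∈ Finset.range (M + 1), (-1 : ℝ) ^ N * Ps N u) * Jt (x - u))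
      atTop (𝓝 (∑' u, (∑' N, (-1 : ℝ) ^ N * Ps N u) * Jt (x - u))) := by
    refine tendsto_tsum_of_dominated_convergence (bound := fun u => (∑' N, Ps N u) * B)
      (hGs.mul_right _) (fun u => (hlimP u).mul_const _) (Eventually.of_forall fun M u => ?_)
    rw [Real.norm_eq_abs, abs_mul]
    exact mul_le_mul (hpart M u) (hJtabs (x - u)) (abs_nonneg _) (tsum_nonneg fun N => hP0 N u)
  -- the remainder tends to `0`
  have hlimR0 : Tendsto (fun M : ℕ => ∑' u, Ps M u * Jt (x - u)) atTop (𝓝 0) := by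
    have hRs : ∀ M, Summable fun u => Ps M u * Jt (x - u) := fun M =>
      Summable.of_norm_bounded ((hPs M).mul_right B) fun u => by
        rw [Real.norm_eq_abs, abs_mul, abs_of_nonneg (hP0 M u)]
        exact mul_le_mul_of_nonneg_left (hJtabs (x - u)) (hP0 M u)
    have hR0 : ∀ M, 0 ≤ ∑' u, Ps M u * Jt (x - u) := fun M =>
      tsum_nonneg fun u => mul_nonneg (hP0 M u) (hJt0 _)
    have hRle : ∀ M, ∑' u, Ps M u * Jt (x - u) ≤ B * (2 * r) * (1 / 2 : ℝ) ^ M := by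
      intro M
      calc ∑' u, Ps M u * Jt (x - u) ≤ ∑' u, Ps M u * B :=
            Summable.tsum_le_tsum (fun u => mul_le_mul_of_nonneg_left (hJtle _) (hP0 M u)) (hRs M)
              ((hPs M).mul_right _)
        _ = B * ∑' u, Ps M u := by rw [tsum_mul_right]; ring
        _ ≤ B * (2 * r * (1 / 2) ^ M) :=
            mul_le_mul_of_nonneg_left ((hP1 M).trans (pow_max_one_le hr0 hr12 M)) hB0
        _ = B * (2 * r) * (1 / 2 : ℝ) ^ M := by ring
    have hgeo : Tendsto (fun M : ℕ => B * (2 * r) * (1 / 2 : ℝ) ^ M) atTop (𝓝 0) := by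
      have h := (tendsto_pow_atTop_nhds_zero_of_lt_one (by norm_num : (0 : ℝ) ≤ 1 / 2)
        (by norm_num : (1 / 2 : ℝ) < 1)).const_mul (B * (2 * r))
      rwa [mul_zero] at h
    exact squeeze_zero hR0 hRle hgeo
  have hlimR : Tendsto (fun M : ℕ => ∑' u, Ps M u * Jt (x - u) + if M = 0 then Jt x else 0) atTop
      (𝓝 0) := by
    refine (hlimR0.congr' ?_)
    filter_upwards [eventually_ge_atTop 1] with M hM
    rw [if_neg (by omega), add_zero]
  -- combine
  have hlimA := tendsto_const_nhds (x := τ x) |>.sub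
    (((tendsto_const_nhds (x := δ x + Jt x)).add hlimConv).add (hlimP x))
  have h0 := le_of_tendsto_of_tendsto' hlimA.abs hlimR fun M => hexp M x
  have h1 := abs_nonpos_iff.1 h0
  linarith

end Derivation

/-! ### Two lemmas about `J` and `Π̃^{(M)}` of `GaussianDominationRouteLaceExpansion.lean` -/

section LaceFacts

open SpreadOutIsing (delta0 latticeConv)

/-- **`(J ⋆ f)(y) = p Σⱼ [f(y - eⱼ) + f(y + eⱼ)]`**: the kernel `J = p𝟙{· ∼ 0}` of (6.2.1) is
supported on the `2d` unit vectors `±eⱼ` (for `d = 0` both sides vanish).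
[cite: HeydenreichVanDerHofstad2017, (6.2.1) (J(x) = 2dpD(x) = p𝟙{x ∼ 0})] -/
theorem latticeConv_bondJ (p : unitInterval) (f : Site d → ℝ) (y : Site d) :
    latticeConv (bondJ d p) f y =
      (p : ℝ) * ∑ j : Fin d, (f (y - Pi.single j 1) + f (y + Pi.single j 1)) := by
  classical
  set e : Fin d → Site d := fun j => Pi.single j (1 : ℤ) with he
  have he_apply : ∀ i j : Fin d, e i j = if j = i then 1 else 0 := fun i j => by
    simp only [he, Pi.single_apply]
  have hinj : Function.Injective e := fun i j hij => by
    by_contra hne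
    have h1 := congrFun hij j
    rw [he_apply, he_apply, if_neg (Ne.symm hne), if_pos rfl] at h1
    exact zero_ne_one h1
  have hinj' : Function.Injective fun j => -e j := fun i j hij => hinj (neg_injective hij)
  have hne : ∀ i j : Fin d, e i ≠ -e j := fun i j h => by
    have h1 := congrFun h i
    rw [Pi.neg_apply, he_apply, he_apply, if_pos rfl] at h1
    by_cases hij : i = j
    · rw [if_pos hij] at h1; norm_num at h1
    · rw [if_neg hij] at h1; norm_num at h1
  have hdisj : Disjoint (Finset.univ.image e) (Finset.univ.image fun j => -e j) := by
    rw [Finset.disjoint_left]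
    intro z hz hz'
    obtain ⟨i, -, rfl⟩ := Finset.mem_image.1 hz
    obtain ⟨j, -, hj⟩ := Finset.mem_image.1 hz'
    exact hne i j hj.symm
  have hsupp : ∀ z ∉ (Finset.univ.image e) ∪ (Finset.univ.image fun j => -e j),
      bondJ d p z * f (y - z) = 0 := by
    intro z hz
    have hnadj : ¬ (zdGraph d).Adj 0 z := by
      intro hadj
      apply hz
      obtain ⟨i, h | h⟩ := (zdGraph_adj_iff 0 z).1 hadj
      · rw [zero_add] at h
        exact Finset.mem_union_left _ (Finset.mem_image.2 ⟨i, Finset.mem_univ _, h.symm⟩)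
      · have hz' : z = -e i := eq_neg_of_add_eq_zero_left h.symm
        exact Finset.mem_union_right _ (Finset.mem_image.2 ⟨i, Finset.mem_univ _, hz'.symm⟩)
    rw [bondJ_def, if_neg hnadj, zero_mul]
  have hadj1 : ∀ j, (zdGraph d).Adj 0 (e j) := fun j =>
    (zdGraph_adj_iff 0 _).2 ⟨j, Or.inl (by rw [zero_add])⟩
  have hadj2 : ∀ j, (zdGraph d).Adj 0 (-e j) := fun j =>
    (zdGraph_adj_iff 0 _).2 ⟨j, Or.inr (by rw [neg_add_cancel])⟩
  rw [latticeConv, tsum_eq_sum hsupp, Finset.sum_union hdisj,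
    Finset.sum_image fun i _ j _ h => hinj h, Finset.sum_image fun i _ j _ h => hinj' h,
    Finset.mul_sum, ← Finset.sum_add_distrib]
  refine Finset.sum_congr rfl fun j _ => ?_
  rw [bondJ_def, if_pos (hadj1 j), bondJ_def, if_pos (hadj2 j), sub_neg_eq_add, mul_add]

/-- `Π̃^{(M)} = Π^{(M)} + δ_{M,0} δ_0` (real parts). [cite: HeydenreichVanDerHofstad2017, (6.2.7)] -/
theorem toReal_lacePiT (p : unitInterval) (M : ℕ) (u : Site d) :
    (lacePiT d p M u).toReal = lacePi d p M u + if M = 0 ∧ u = 0 then 1 else 0 := by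
  rw [lacePi_def]; ring

end LaceFacts

end Literature.Barriers.CriticalPhenomena

end
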